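import Literature.AnabelianGeometry.EtaleTheta.Setting
import Literature.AnabelianGeometry.EtaleTheta.SettingModelHeisenberg
import Mathlib.GroupTheory.Nilpotent
import Mathlib.GroupTheory.Perm.Fin
import HarnessLib

/-!
# A nilpotent group is not a free profinite group on two generators; in particular no Heisenberg group
# (and no subgroup of one) is — the «literal» χ-twisted candidate for the [EtTh] §1 root fails `IsEtThOrigin`

Mochizuki, *The étale theta function …*, Publ. RIMS **45** (2009) [EtTh], §1, PRIMS PDF p. 12: "`Δ_X` is a
profinite free group on 2 generators" [cite: MochizukiEtTh2009, §1 p.12] — typed by abc-iut-L2-t1 as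
`IsFreeProfiniteOnTwo` (`Setting.lean`: compact, Hausdorff, totally disconnected, and the universal property
against FINITE discrete groups for a pair `a, b`), the hypothesis through which `IsEtThOrigin` is reached
(`IsEtThOrigin.of_free`, `isEtThOrigin_iff_free`).

Layer L2 of the abc-iut cell, R78 cluster («χ-twisted root model»), file **F0** of abc-iut-L6-d6's map
(abc-iut-L2-lead ROWS #13 R100), seat abc-iut-w5-d034.  PROOF-ONLY (no `def`, no instance, no named fact).
It records, in the kernel, WHY the literal candidate "`Π^tp_X := H ⋊_χ G_{ℚ_p}` with `H` the mixed
Heisenberg group" of R78 cannot satisfy the guard `IsEtThOrigin`: its `Δ_X` would be (a closed subgroup of) a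
Heisenberg group `Heis(Ẑ)`, nilpotent of class `2`, whereas a free profinite group on two generators maps
continuously ONTO the symmetric group `S₃` — which no nilpotent group does.  Hence abc-iut-L6-d6's RESHAPE
(B) (the mixed Heisenberg group is the theta QUOTIENT `(Π^tp_X)^Θ`, not `Π^tp_X`).

* `IsFreeProfiniteOnTwo.exists_monoidHom_perm_fin_three` — the universal property at `Q := Equiv.Perm (Fin 3)`:
  a homomorphism `f : P → S₃` with open fibres and `f a = (0 1)`, `f b = (1 2)`; it is onto (`…_surjective`:
  the two transpositions generate `S₃`, `closure_swap_zero_one_swap_one_two`).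
* `not_isFreeProfiniteOnTwo_of_isNilpotent` — **no nilpotent topological group is free profinite on two
  generators**: the iterated commutators `⁅…⁅⁅a,b⁆,a⁆…,a⁆` lie in the lower central series, which reaches `⊥`,
  but their images `⁅…⁅⁅(0 1),(1 2)⁆,(0 1)⁆…,(0 1)⁆` are the 3-cycles of `S₃`, never `1`.
* `not_isFreeProfiniteOnTwo_of_commutator_central` / `…_of_commutator_commutator_eq_bot` — the class-`≤ 2`
  forms used by the cluster.
* `Heis.not_isFreeProfiniteOnTwo`, `Heis.not_isFreeProfiniteOnTwo_subgroup`,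
  `not_isFreeProfiniteOnTwo_of_injective_into_heis` — for EVERY commutative ring `R`, EVERY topology and EVERY
  subgroup of abc-iut-L2-t1's `Heis R` (`SettingModelHeisenberg.lean`, `Heis.commutator_commutator_top_eq_bot`),
  and every topological group admitting an injective homomorphism into some `Heis R`.

HONEST FRAMING: elementary group theory about OUR typed predicate; a statement about which synthetic
models can reach the typed guard, nothing about [EtTh] itself; no side taken on [IUTchIII] Cor. 3.12.
-/

namespace Literature.AnabelianGeometry.EtaleTheta

open scoped commutatorElement

universe u

section General

variable {P : Type u} [Group P] [TopologicalSpace P]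

/-! ### The universal property at `S₃` -/

/-- A free profinite group on two generators `a, b` admits a homomorphism to `S₃ = Equiv.Perm (Fin 3)` with
OPEN fibres (= continuous for the discrete topology on `S₃`) and `a ↦ (0 1)`, `b ↦ (1 2)` — the universal
property of `IsFreeProfiniteOnTwo` at the finite group `S₃`. [cite: MochizukiEtTh2009, §1 p.12] -/
theorem IsFreeProfiniteOnTwo.exists_monoidHom_perm_fin_three (h : IsFreeProfiniteOnTwo P) :
    ∃ (a b : P) (f : P →* Equiv.Perm (Fin 3)), (∀ q, IsOpen (f ⁻¹' {q})) ∧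
      f a = Equiv.swap 0 1 ∧ f b = Equiv.swap 1 2 := by
  obtain ⟨_, _, _, a, b, huniv⟩ := h
  letI : TopologicalSpace (Equiv.Perm (Fin 3)) := ⊥
  haveI : DiscreteTopology (Equiv.Perm (Fin 3)) := ⟨rfl⟩
  obtain ⟨f, ⟨hfa, hfb⟩, -⟩ := huniv (Equiv.Perm (Fin 3)) (Equiv.swap 0 1) (Equiv.swap 1 2)
  have hfc : Continuous f.toMonoidHom := f.continuous_toFun
  exact ⟨a, b, f.toMonoidHom, fun q => (isOpen_discrete {q}).preimage hfc, hfa, hfb⟩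

/-- The transpositions `(0 1)` and `(1 2)` generate `S₃`. [folklore] -/
private theorem closure_swap_zero_one_swap_one_two :
    Subgroup.closure ({Equiv.swap 0 1, Equiv.swap 1 2} : Set (Equiv.Perm (Fin 3))) = ⊤ := by
  apply le_antisymm le_top
  have h01 : Equiv.swap (0 : Fin 3) 1 ∈ Subgroup.closure ({Equiv.swap 0 1, Equiv.swap 1 2} :
      Set (Equiv.Perm (Fin 3))) := Subgroup.subset_closure (by simp)
  have h12 : Equiv.swap (1 : Fin 3) 2 ∈ Subgroup.closure ({Equiv.swap 0 1, Equiv.swap 1 2} :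
      Set (Equiv.Perm (Fin 3))) := Subgroup.subset_closure (by simp)
  -- every element of `S₃` is one of six words in the two transpositions
  have key : ∀ σ : Equiv.Perm (Fin 3), σ = 1 ∨ σ = Equiv.swap 0 1 ∨ σ = Equiv.swap 1 2 ∨
      σ = Equiv.swap 0 1 * Equiv.swap 1 2 ∨ σ = Equiv.swap 1 2 * Equiv.swap 0 1 ∨
      σ = Equiv.swap 0 1 * Equiv.swap 1 2 * Equiv.swap 0 1 := by
    decide
  intro σ _
  rcases key σ with h | h | h | h | h | h <;> rw [h]
  · exact one_mem _
  · exact h01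
  · exact h12
  · exact mul_mem h01 h12
  · exact mul_mem h12 h01
  · exact mul_mem (mul_mem h01 h12) h01

/-- **A free profinite group on two generators maps continuously ONTO `S₃`** (open fibres).
[cite: MochizukiEtTh2009, §1 p.12] -/
theorem IsFreeProfiniteOnTwo.exists_monoidHom_perm_fin_three_surjective (h : IsFreeProfiniteOnTwo P) :
    ∃ f : P →* Equiv.Perm (Fin 3), (∀ q, IsOpen (f ⁻¹' {q})) ∧ Function.Surjective f := by
  obtain ⟨a, b, f, hfo, hfa, hfb⟩ := h.exists_monoidHom_perm_fin_three
  refine ⟨f, hfo, ?_⟩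
  rw [← MonoidHom.range_eq_top, eq_top_iff, ← closure_swap_zero_one_swap_one_two, Subgroup.closure_le]
  rintro σ (rfl | rfl)
  · exact ⟨a, hfa⟩
  · exact ⟨b, hfb⟩

/-! ### Iterated commutators: in the lower central series upstairs, `3`-cycles downstairs -/

omit [TopologicalSpace P] in
/-- The iterated commutator `⁅…⁅⁅a,b⁆,a⁆…,a⁆` (`n` extra brackets) lies in the `(n+1)`-st term of the lower
central series. [folklore] -/
private theorem iterate_commutator_mem_lowerCentralSeries (a b : P) (n : ℕ) :
    (fun g => ⁅g, a⁆)^[n] ⁅a, b⁆ ∈ (⊤ : Subgroup P).lowerCentralSeries (n + 1) := by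
  induction n with
  | zero =>
    rw [Function.iterate_zero, id, zero_add, Subgroup.lowerCentralSeries_succ,
      Subgroup.lowerCentralSeries_zero]
    exact Subgroup.commutator_mem_commutator (Subgroup.mem_top a) (Subgroup.mem_top b)
  | succ n ih =>
    rw [Function.iterate_succ_apply', Subgroup.lowerCentralSeries_succ]
    exact Subgroup.commutator_mem_commutator ih (Subgroup.mem_top a)

omit [TopologicalSpace P] in
/-- A homomorphism carries iterated commutators to iterated commutators. [folklore] -/
private theorem map_iterate_commutator {Q : Type*} [Group Q] (f : P →* Q) (a b : P) (n : ℕ) :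
    f ((fun g => ⁅g, a⁆)^[n] ⁅a, b⁆) = (fun g => ⁅g, f a⁆)^[n] ⁅f a, f b⁆ := by
  induction n with
  | zero => rw [Function.iterate_zero, Function.iterate_zero, id, id, map_commutatorElement]
  | succ n ih => rw [Function.iterate_succ_apply', Function.iterate_succ_apply', map_commutatorElement, ih]

/-- In `S₃` the iterated commutators `⁅…⁅⁅(0 1),(1 2)⁆,(0 1)⁆…,(0 1)⁆` are the two `3`-cycles, alternately —
in particular never the identity. [folklore] -/
private theorem iterate_commutator_swap_ne_one (n : ℕ) :
    (fun g : Equiv.Perm (Fin 3) => ⁅g, Equiv.swap (0 : Fin 3) 1⁆)^[n]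
        ⁅Equiv.swap (0 : Fin 3) 1, Equiv.swap (1 : Fin 3) 2⁆ ≠ 1 := by
  -- invariant: the iterate is `c` or `c⁻¹` for the 3-cycle `c := ⁅(0 1), (1 2)⁆`
  have inv : ∀ m : ℕ,
      (fun g : Equiv.Perm (Fin 3) => ⁅g, Equiv.swap (0 : Fin 3) 1⁆)^[m]
          ⁅Equiv.swap (0 : Fin 3) 1, Equiv.swap (1 : Fin 3) 2⁆ =
          ⁅Equiv.swap (0 : Fin 3) 1, Equiv.swap (1 : Fin 3) 2⁆ ∨
        (fun g : Equiv.Perm (Fin 3) => ⁅g, Equiv.swap (0 : Fin 3) 1⁆)^[m]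
          ⁅Equiv.swap (0 : Fin 3) 1, Equiv.swap (1 : Fin 3) 2⁆ =
          ⁅Equiv.swap (0 : Fin 3) 1, Equiv.swap (1 : Fin 3) 2⁆⁻¹ := by
    intro m
    induction m with
    | zero => exact Or.inl (Function.iterate_zero_apply _ _)
    | succ m ih =>
      rw [Function.iterate_succ_apply']
      rcases ih with h | h <;> rw [h]
      · right
        simp only [commutatorElement_def]
        decide
      · left
        simp only [commutatorElement_def]
        decide
  intro hn
  rcases inv n with h | h <;> rw [hn] at h
  · have : (1 : Equiv.Perm (Fin 3)) ≠ ⁅Equiv.swap (0 : Fin 3) 1, Equiv.swap (1 : Fin 3) 2⁆ := by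
      simp only [commutatorElement_def]
      decide
    exact this h
  · have : (1 : Equiv.Perm (Fin 3)) ≠ ⁅Equiv.swap (0 : Fin 3) 1, Equiv.swap (1 : Fin 3) 2⁆⁻¹ := by
      simp only [commutatorElement_def]
      decide
    exact this h

/-! ### No nilpotent group is free profinite on two generators -/

/-- **A nilpotent topological group is not a free profinite group on two generators** (for any topology):
the universal property at `S₃` would give an `f` with `f a = (0 1)`, `f b = (1 2)`; the iterated commutator
`⁅…⁅⁅a,b⁆,a⁆…,a⁆` lies in a trivial term of the lower central series, yet maps to a `3`-cycle.
[cite: MochizukiEtTh2009, §1 p.12] -/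
theorem not_isFreeProfiniteOnTwo_of_isNilpotent [Group.IsNilpotent P] : ¬ IsFreeProfiniteOnTwo P := by
  intro h
  obtain ⟨a, b, f, -, hfa, hfb⟩ := h.exists_monoidHom_perm_fin_three
  obtain ⟨n, hn⟩ := Subgroup.nilpotent_iff_lowerCentralSeries.mp (inferInstance : Group.IsNilpotent P)
  have hmem : (fun g => ⁅g, a⁆)^[n] ⁅a, b⁆ ∈ (⊤ : Subgroup P).lowerCentralSeries n :=
    Subgroup.lowerCentralSeries_antitone ⊤ (Nat.le_succ n) (iterate_commutator_mem_lowerCentralSeries a b n)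
  rw [hn, Subgroup.mem_bot] at hmem
  have himg := map_iterate_commutator f a b n
  rw [hmem, map_one, hfa, hfb] at himg
  exact iterate_commutator_swap_ne_one n himg.symm

/-- **Class `≤ 2` form**: if all commutators of `P` are central (`⁅⁅x,y⁆,z⁆ = 1`), then `P` is not a free
profinite group on two generators. [cite: MochizukiEtTh2009, §1 p.12] -/
theorem not_isFreeProfiniteOnTwo_of_commutator_central (h : ∀ x y z : P, ⁅⁅x, y⁆, z⁆ = 1) :
    ¬ IsFreeProfiniteOnTwo P := by
  intro hf
  obtain ⟨a, b, f, -, hfa, hfb⟩ := hf.exists_monoidHom_perm_fin_three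
  have himg := map_iterate_commutator f a b 1
  rw [Function.iterate_one, h a b a, map_one, hfa, hfb] at himg
  exact iterate_commutator_swap_ne_one 1 himg.symm

/-- Class `≤ 2` in subgroup form: `⁅⁅P,P⁆,P⁆ = ⊥` excludes `IsFreeProfiniteOnTwo P`.
[cite: MochizukiEtTh2009, §1 p.12] -/
theorem not_isFreeProfiniteOnTwo_of_commutator_commutator_eq_bot
    (h : ⁅⁅(⊤ : Subgroup P), (⊤ : Subgroup P)⁆, (⊤ : Subgroup P)⁆ = ⊥) : ¬ IsFreeProfiniteOnTwo P := by
  refine not_isFreeProfiniteOnTwo_of_commutator_central fun x y z => ?_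
  have hx : ⁅⁅x, y⁆, z⁆ ∈ (⁅⁅(⊤ : Subgroup P), (⊤ : Subgroup P)⁆, (⊤ : Subgroup P)⁆ : Subgroup P) :=
    Subgroup.commutator_mem_commutator
      (Subgroup.commutator_mem_commutator (Subgroup.mem_top x) (Subgroup.mem_top y)) (Subgroup.mem_top z)
  rwa [h, Subgroup.mem_bot] at hx

/-- Transfer along an injective homomorphism: a topological group that embeds (as an abstract group) into a
group of class `≤ 2` is not free profinite on two generators. [cite: MochizukiEtTh2009, §1 p.12] -/
theorem not_isFreeProfiniteOnTwo_of_injective {H : Type*} [Group H] (φ : P →* H)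
    (hφ : Function.Injective φ) (hH : ∀ x y z : H, ⁅⁅x, y⁆, z⁆ = 1) : ¬ IsFreeProfiniteOnTwo P := by
  refine not_isFreeProfiniteOnTwo_of_commutator_central fun x y z => hφ ?_
  rw [map_commutatorElement, map_commutatorElement, map_one]
  exact hH _ _ _

end General

/-! ### Heisenberg groups (abc-iut-L2-t1's `Heis R`) -/

namespace SettingModel

namespace Heis

variable {R : Type*} [CommRing R]

/-- In a Heisenberg group every double commutator is trivial (class `≤ 2`; abc-iut-L2-t1's
`Heis.commutator_commutator_top_eq_bot`, element form). [cite: MochizukiEtTh2009, §1 p.12] -/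
theorem commutator_commutator_eq_one (x y z : Heis R) : ⁅⁅x, y⁆, z⁆ = 1 := by
  have hx : ⁅⁅x, y⁆, z⁆ ∈ (⁅⁅(⊤ : Subgroup (Heis R)), (⊤ : Subgroup (Heis R))⁆, (⊤ : Subgroup (Heis R))⁆ :
      Subgroup (Heis R)) :=
    Subgroup.commutator_mem_commutator
      (Subgroup.commutator_mem_commutator (Subgroup.mem_top x) (Subgroup.mem_top y)) (Subgroup.mem_top z)
  rwa [commutator_commutator_top_eq_bot, Subgroup.mem_bot] at hx

variable (R) in
/-- **No Heisenberg group is a free profinite group on two generators**, whatever topology it carries — in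
particular `Heis(Ẑ)`, the `Δ_X` of the literal χ-twisted candidate of the abc-iut R78 cluster, cannot satisfy
`IsEtThOrigin.deltaHat_free`. [cite: MochizukiEtTh2009, §1 p.12] -/
theorem not_isFreeProfiniteOnTwo [TopologicalSpace (Heis R)] : ¬ IsFreeProfiniteOnTwo (Heis R) :=
  not_isFreeProfiniteOnTwo_of_commutator_central commutator_commutator_eq_one

/-- … nor is any subgroup of a Heisenberg group (e.g. the closure of a dense image of the mixed Heisenberg
group `{(a,b,c) : a,c ∈ Ẑ, b ∈ ℤ}`), whatever topology it carries. [cite: MochizukiEtTh2009, §1 p.12] -/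
theorem not_isFreeProfiniteOnTwo_subgroup (K : Subgroup (Heis R)) [TopologicalSpace K] :
    ¬ IsFreeProfiniteOnTwo K :=
  not_isFreeProfiniteOnTwo_of_injective K.subtype K.subtype_injective commutator_commutator_eq_one

end Heis

/-- … nor is any topological group admitting an injective homomorphism into some `Heis R` (the shape in
which a synthetic `Δ_X` would be compared with a Heisenberg carrier). [cite: MochizukiEtTh2009, §1 p.12] -/
theorem not_isFreeProfiniteOnTwo_of_injective_into_heis {P : Type*} [Group P] [TopologicalSpace P]
    {R : Type*} [CommRing R] (φ : P →* Heis R) (hφ : Function.Injective φ) : ¬ IsFreeProfiniteOnTwo P :=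
  not_isFreeProfiniteOnTwo_of_injective φ hφ Heis.commutator_commutator_eq_one

end SettingModel

end Literature.AnabelianGeometry.EtaleTheta
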